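import Mathlib
import Summits.QuantumFields.BalabanUV.T4Continuum.Support.SliceTorusSkeleton
import Summits.QuantumFields.BalabanUV.T4Continuum.Support.SliceTorusFaces

/-!
# T⁴ programme, node NE3 (η-rate of the minimisers) — the slice-operator torus model on the INTERNAL-INDEX
# carrier `(ℤ/NLⁿ)^d × Cp`: geometry binders, slice bounds of printed type, the unit-face skeleton with colours,
# and the consistency composition with a ZERO-SHELL COUNT

Thirteenth generation of the NE3 prover lineage P1 of the cell `pub-balaban` (technique: implicit-function / fixed-point
structure of the one-step constrained variational problem, Bałaban CMP 102 (1985) = "B11", Sect. E, read as the DISCRETE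
implicit-function theorem = STABILITY × CONSISTENCY).  The six-file torus series (`SliceTorusBlocks` … `SliceTorusFaces`,
`SliceTorusFacesSkeleton`) carries NE3's typed skeleton on the SCALAR fine carrier `TPt d (N·Lⁿ) = (ℤ/NLⁿ)^d`; Bałaban's
propagators are End(𝔤)-valued, and the covariant realisation of the operator model (`SliceCovariantModel`, generation 12)
lives on an internal-index fine type `St × Cp`.  THIS FILE moves the torus series to the carrier
`TPt d (N·Lⁿ) × Cp` (a site and a colour/component index), with NO new mathematics:
 * §1 the block maps `cubeI j = cube j ∘ Prod.fst`, the fine distance `rhoI` / integer distance `nplI` OF THE SITES, and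
   the nine geometry binders of `T4SliceOperatorData.sliceKernel_bound_of_printedType` transported along `Prod.fst` from
   `SliceTorusTower` (the coarse block geometries `TPt d (levM n N L j)` are UNCHANGED — only the fine carrier grows);
 * §2 `sliceKernel_bound_torusI_of_printedType`: King's (3.63) shape for every slice on the internal-index carrier from
   (3.42)/(3.49) of printed TYPE, by name (`B9.Ineq342_346_347` / `B9.Ineq349` for `matrixFamily (cubeI j)` /
   `fineKernelOf (cubeI j)`), verbatim the torus theorem with `X := TPt d (N·Lⁿ) × Cp`;
 * §3 the unit-face skeleton with colours `faceSkelI = faceSkel ×ˢ univ`: diameter `nplI ≤ d·(N·L^k)`, shells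
   `#{q ∈ faceSkelI : nplI p q = r} ≤ #Cp·A_f·r^{d−2}` (`r ≥ 1`) and the NEW zero shell `≤ #Cp` (on the scalar carrier the
   zero shell is `{x}`, which is why `T4SliceTelescoping.doubleLayerRow_le` asks `hzero : nρ x y = 0 → y = x`; with an
   internal index the zero shell is `{x} × Cp`);
 * §4 the consistency composition with a zero-shell COUNT in place of `hzero` (generic carrier):
   `doubleLayerRow_le_card0`, `consistencyT2_of_slices_card0` and `ne3Shape_of_slices_rpow_card0` =
   `T4TwoSpacingDefect.ne3Shape_of_consistency_rpow` ∘ (`layer_sum_le` with `e₀ = A₀·2C`) — the double-layer constant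
   becomes `C_DL = A₀·2C + A·C·K_δ·(1 + log ℓ)`.
The successor file `SliceCovariantSkeleton` plugs the DEFINED covariant operators of `SliceCovariantModel` (`gLev`,
`kPart` over combs with `blk = cube`) into these theorems.

Honest framing: finite-T⁴ ultraviolet bookkeeping about MINIMISERS (rung (B)+1 of the cell's ladder); no conditional of
the cell (`BetaPertH`, (B), (B^μ)) is used or hidden; nothing bears on infinite volume, a mass gap, or the Clay problem;
**NE3 is NOT proved**.  ABSOLUTE RULE of the cell kept: no internally-minted statement enters as a cited fact; B9's
theorems enter only as HYPOTHESES of the tree's typed, cite-tagged shapes (`B9.Ineq342_346_347`, `B9.Ineq349`); the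
manuscripts under audit are not cited for any disputed step.  No `sorry`, no axioms beyond Mathlib's; everything is
[folklore] finite sums / integer arithmetic or [model] dictionary.  PLACEMENT (human rule 2026-08-19): cell work under
`Summits/QuantumFields/BalabanUV/`; imports `Support.SliceTorusSkeleton` (p195531) and `Support.SliceTorusFaces` (p195807);
moves nothing.  Records: `t4/T4-EST-U1b-OSC.md` v1.25, `t4/T4-EST-NE3-P1.md` v2.24, GAPS G-ne3p1-39 of the cell
`pub-balaban`.
-/

noncomputable section

open Finset Real

namespace Summit.QuantumFields.BalabanUV.T4Continuum.SliceCovariantTower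

open Literature.MathematicalPhysics.QuantumFieldTheory.Balaban1983to89
open Literature.MathematicalPhysics.QuantumFieldTheory.Balaban1983to89.TreeLengthTorus (TPt)
open Literature.MathematicalPhysics.QuantumFieldTheory.Balaban1983to89.T4SliceTelescoping
  (sliceKernel sliceConst sliceConst_nonneg core_of_slices profile_of_slices)
open Literature.MathematicalPhysics.QuantumFieldTheory.Balaban1983to89.T4TwoSpacingDefect
  (layer_sum_le rowConst_le ConsistencySized ne3Shape_of_consistency_rpow)
open Literature.MathematicalPhysics.QuantumFieldTheory.Balaban1983to89.T4EtaRateMin (Readings NE3Shape)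
open Literature.MathematicalPhysics.QuantumFieldTheory.Balaban1983to89.T4FixedPointResponse (OneStepCorrectionRate)
open Literature.MathematicalPhysics.QuantumFieldTheory.Balaban1983to89.T4SliceOperatorData
open Summit.QuantumFields.BalabanUV.T4Continuum.SliceTorusBlocks
open Summit.QuantumFields.BalabanUV.T4Continuum.SliceTorusBlockModel
open Summit.QuantumFields.BalabanUV.T4Continuum.SliceTorusTower
open Summit.QuantumFields.BalabanUV.T4Continuum.SliceTorusFaces

/-! ## §1  The internal-index fine carrier `(ℤ/NLⁿ)^d × Cp` and its geometry binders -/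
section Carrier

variable (d n N L : ℕ) (Cp : Type)

/-- The level-`j` BLOCK MAP on the internal-index carrier: the block of the SITE (`x ∈ Δ(y)` reads `cube j x = y`; the
colour index is carried along). [model] [folklore] -/
def cubeI (j : ℕ) (p : TPt d (N * L ^ n) × Cp) : TPt d (levM n N L j) := cube d n N L j p.1

/-- The fine distance of two sites-with-colour = the periodic ℓ¹ distance of the SITES. [model] [folklore] -/
def rhoI (p q : TPt d (N * L ^ n) × Cp) : ℝ := rho d n N L p.1 q.1

/-- The integer fine distance of two sites-with-colour = `npl1` of the sites. [model] [folklore] -/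
def nplI (p q : TPt d (N * L ^ n) × Cp) : ℕ := npl1 (p.1 - q.1)

variable {d n N L Cp}

/-- `nplI` cast to `ℝ` is `rhoI`. [folklore] -/
theorem cast_nplI (p q : TPt d (N * L ^ n) × Cp) : (nplI d n N L Cp p q : ℝ) = rhoI d n N L Cp p q :=
  cast_npl1 _

/-- `cubeI j p = cube j p.1`. [folklore] -/
@[simp] theorem cubeI_apply (j : ℕ) (p : TPt d (N * L ^ n) × Cp) : cubeI d n N L Cp j p = cube d n N L j p.1 := rfl

variable (d n N L Cp)

/-- Binder `hρ0`. [folklore] -/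
theorem rhoI_nonneg (p q : TPt d (N * L ^ n) × Cp) : 0 ≤ rhoI d n N L Cp p q := rho_nonneg d n N L p.1 q.1

/-- Binder `hρsymm`. [folklore] -/
theorem rhoI_comm (p q : TPt d (N * L ^ n) × Cp) : rhoI d n N L Cp p q = rhoI d n N L Cp q p :=
  rho_comm d n N L p.1 q.1

variable [NeZero N] [NeZero L]

/-- Binder `htri`. [folklore] -/
theorem rhoI_triangle (p z w q : TPt d (N * L ^ n) × Cp) :
    rhoI d n N L Cp p q ≤ rhoI d n N L Cp p z + rhoI d n N L Cp z w + rhoI d n N L Cp w q :=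
  rho_triangle d n N L p.1 z.1 w.1 q.1

/-- Binder `hρbd` with `c = d`. [folklore] -/
theorem rhoI_le_nbd (j : ℕ) (p z : TPt d (N * L ^ n) × Cp) :
    rhoI d n N L Cp p z
      ≤ (L : ℝ) ^ j * nbd d n N L j (cubeI d n N L Cp j p) (cubeI d n N L Cp j z) + d * (L : ℝ) ^ j :=
  rho_le_nbd d n N L j p.1 z.1

/-- Binder `hnest`. [folklore] -/
theorem cubeI_nest (j : ℕ) {z w : TPt d (N * L ^ n) × Cp} (h : cubeI d n N L Cp j z = cubeI d n N L Cp j w) :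
    cubeI d n N L Cp (j + 1) z = cubeI d n N L Cp (j + 1) w :=
  cube_nest d n N L j h

/-- Binder `hdiam` with `c = d`. [folklore] -/
theorem rhoI_le_of_cubeI_succ_eq (j : ℕ) {z w : TPt d (N * L ^ n) × Cp}
    (h : cubeI d n N L Cp (j + 1) z = cubeI d n N L Cp (j + 1) w) : rhoI d n N L Cp z w ≤ d * (L : ℝ) ^ (j + 1) :=
  rho_le_of_cube_succ_eq d n N L j h

end Carrier

/-! ## §2  The slice bounds of printed TYPE on the internal-index carrier -/
section PrintedType

variable (d n N L : ℕ) [NeZero N] [NeZero L] (Cp : Type) [Fintype Cp]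

/-- **THE SLICE BOUNDS `hg` ON `(ℤ/NLⁿ)^d × Cp` FROM (3.42)/(3.49) OF PRINTED TYPE** — `sliceKernel_bound_torus_of_printedType`
verbatim on the internal-index carrier: per level `j`, `A j m U` four background-dependent matrices carried as
`matrixFamily (cubeI j)`, `F j n U` four matrices carried as `fineKernelOf (cubeI j)`, identifications `A j 0 (U j) = G j`,
`A j 1 (U j) = (G j·D)ᵀ`, `F j 3 (U j) = Ng j`, operator model `K j = massKernel (cubeI j) (τ j) (a_j/(L^j)^{d+2}) + Ng j`;
HYPOTHESES OF PRINTED TYPE BY NAME `h342`, `h349` with LEVEL-FREE constants; CONCLUSION King's (3.63) shape for every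
slice with `C_A = printedCA B₀ δ₀ δ d 2^d d`, `C_P = printedCP a C₃ δ₁ δ L d d`.  HONEST: the reading that B9's Theorem
3.1/3.3 and (3.49) give `h342`/`h349` for the auxiliary propagators is NOT made here. [folklore] -/
theorem sliceKernel_bound_torusI_of_printedType (Mbig : ℝ)
    (dist : ∀ j : ℕ, TPt d (levM n N L j) → TPt d (levM n N L j) → ℝ)
    (Bg : ℕ → B9.Backgrounds) (U : ∀ j, (Bg j).Cfg)
    (A F : ∀ j, Fin 4 → (Bg j).Cfg → Matrix (TPt d (N * L ^ n) × Cp) (TPt d (N * L ^ n) × Cp) ℝ)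
    (G Ng K : ℕ → Matrix (TPt d (N * L ^ n) × Cp) (TPt d (N * L ^ n) × Cp) ℝ)
    (D : Matrix (TPt d (N * L ^ n) × Cp) (TPt d (N * L ^ n) × Cp) ℝ)
    (τ : ℕ → TPt d (N * L ^ n) × Cp → TPt d (N * L ^ n) × Cp → ℝ) (am : ℕ → ℝ) {B₀ δ₀ C₃ δ₁ δ a : ℝ}
    (hd : 1 ≤ d) (hB₀ : 0 ≤ B₀) (hC₃ : 0 ≤ C₃) (hδ : 0 ≤ δ) (hδ₀ : δ < δ₀) (hδ₁ : δ ≤ δ₁ / 2) (ha : 0 ≤ a)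
    (hbd : ∀ j y y₁, (nbd d n N L j y y₁ : ℝ) ≤ dist j y y₁)
    (hA0 : ∀ j, A j 0 (U j) = G j) (hA1 : ∀ j, A j 1 (U j) = (G j * D).transpose)
    (hF3 : ∀ j, F j 3 (U j) = Ng j)
    (h342 : ∀ j, B9.Ineq342_346_347
      (matrixFamily (cubeI d n N L Cp j) (dist j) j (L : ℝ) Mbig (A j)) B₀ δ₀ (U j))
    (h349 : ∀ j, B9.Ineq349 d
      (fineKernelOf (cubeI d n N L Cp j) (dist j) j (L : ℝ) Mbig (F j)) C₃ δ₁ (U j))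
    (hτ : ∀ j z w, |τ j z w| ≤ 1) (ham : ∀ j, 0 ≤ am j ∧ am j ≤ a)
    (hK : ∀ j, K j = massKernel (cubeI d n N L Cp j) (τ j) (am j / ((L : ℝ) ^ j) ^ (d + 2)) + Ng j) :
    ∀ i x y, |sliceKernel G K D i x y|
      ≤ printedCA B₀ δ₀ δ d ((2 : ℝ) ^ d) d * (1 + printedCA B₀ δ₀ δ d ((2 : ℝ) ^ d) d * printedCP a C₃ δ₁ δ L d d)
        * (Real.exp (-(δ * (rhoI d n N L Cp x y / (L : ℝ) ^ i))) / ((L : ℝ) ^ i) ^ (d - 1)) := by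
  have hL : (1 : ℝ) ≤ L := by exact_mod_cast one_le_L L
  refine sliceKernel_bound_of_printedType (fun j => blockGeom (cubeI d n N L Cp j) (dist j) j (L : ℝ) Mbig) Bg
    (fun j => matrixFamily (cubeI d n N L Cp j) (dist j) j (L : ℝ) Mbig (A j))
    (fun j => fineKernelOf (cubeI d n N L Cp j) (dist j) j (L : ℝ) Mbig (F j)) U
    (cubeI d n N L Cp) (nbd d n N L) G Ng K D τ am (rhoI d n N L Cp) hd hL hB₀ hC₃ hδ hδ₀ hδ₁ (by positivity) ha
    (rhoI_nonneg d n N L Cp) (rhoI_comm d n N L Cp) (rhoI_triangle d n N L Cp)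
    (fun j y => len_blockGeom _ _ _ _ _ y)
    hbd (rhoI_le_nbd d n N L Cp) (card_nbd_eq_le d n N L)
    (fun j z w h => cubeI_nest d n N L Cp j h) (fun j z w h => rhoI_le_of_cubeI_succ_eq d n N L Cp j h)
    h342 h349 (fun j => ?_) (fun j => ?_) (fun j => ?_) hτ ham hK
  · rw [← hA0 j]
    exact rowObservedBy_matrixFamily _ _ _ _ _ (A j) (U j) 0
  · rw [← hA1 j]
    exact rowObservedBy_matrixFamily _ _ _ _ _ (A j) (U j) 1
  · rw [← hF3 j]
    exact entryDominated_fineKernelOf _ _ _ _ _ (F j) (U j) 3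

end PrintedType

/-! ## §3  The unit-face skeleton with colours and its shell counts -/
section Faces

variable (d k N L : ℕ) [NeZero N] [NeZero L] (Cp : Type) [Fintype Cp]

/-- **The unit-face skeleton with colours** `faceSkel ×ˢ univ`: the sites-with-colour whose SITE lies on a lower face of
its unit block. [model] [folklore] -/
def faceSkelI : Finset (TPt d (N * L ^ k) × Cp) := faceSkel d k N L ×ˢ Finset.univ

variable {d k N L Cp}

omit [Fintype Cp] in
/-- Binder `hFN`: the integer fine distance never exceeds `d·(N·L^k)` (the diameter of the torus). [folklore] -/
theorem nplI_le (p q : TPt d (N * L ^ k) × Cp) : nplI d k N L Cp p q ≤ d * (N * L ^ k) := npl1_le _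

/-- The `r`-shell of the coloured skeleton about `p` is the `r`-shell of the skeleton about `p.1`, times all colours.
[folklore] -/
theorem faceSkelI_filter_eq (p : TPt d (N * L ^ k) × Cp) (r : ℕ) :
    (faceSkelI d k N L Cp).filter (fun q => nplI d k N L Cp p q = r)
      = ((faceSkel d k N L).filter fun y => npl1 (p.1 - y) = r) ×ˢ (Finset.univ : Finset Cp) := by
  ext q
  simp only [faceSkelI, nplI, Finset.mem_filter, Finset.mem_product, Finset.mem_univ, and_true]

/-- **Binder `hcard` for the coloured skeleton**: for `r ≥ 1`, `#{q ∈ faceSkelI : nplI p q = r} ≤ (#Cp·A_f)·r^{d−2}`.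
[folklore] -/
theorem card_faceSkelI_shell_le (hd : 2 ≤ d) (p : TPt d (N * L ^ k) × Cp) (r : ℕ) (hr : 1 ≤ r) :
    (((faceSkelI d k N L Cp).filter fun q => nplI d k N L Cp p q = r).card : ℝ)
      ≤ (Fintype.card Cp * faceConst d N) * (r : ℝ) ^ (d - 2) := by
  rw [faceSkelI_filter_eq, Finset.card_product, Finset.card_univ, Nat.cast_mul]
  have h := card_faceSkel_shell_le (k := k) (N := N) (L := L) hd p.1 r hr
  have hc : (0 : ℝ) ≤ Fintype.card Cp := Nat.cast_nonneg _
  calc (((faceSkel d k N L).filter fun y => npl1 (p.1 - y) = r).card : ℝ) * (Fintype.card Cp : ℝ)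
      ≤ faceConst d N * (r : ℝ) ^ (d - 2) * (Fintype.card Cp : ℝ) := mul_le_mul_of_nonneg_right h hc
    _ = (Fintype.card Cp * faceConst d N) * (r : ℝ) ^ (d - 2) := by ring

/-- **The ZERO shell of the coloured skeleton** about `p` has at most `#Cp` elements (it lies in `{p.1} × Cp`).
[folklore] -/
theorem card_faceSkelI_zero_le (p : TPt d (N * L ^ k) × Cp) :
    (((faceSkelI d k N L Cp).filter fun q => nplI d k N L Cp p q = 0).card : ℝ) ≤ Fintype.card Cp := by
  rw [faceSkelI_filter_eq, Finset.card_product, Finset.card_univ, Nat.cast_mul]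
  have hsub : (faceSkel d k N L).filter (fun y => npl1 (p.1 - y) = 0) ⊆ {p.1} := by
    intro y hy
    rw [Finset.mem_singleton]
    exact eq_of_npl1_sub_eq_zero (Finset.mem_filter.1 hy).2
  have h1 : (((faceSkel d k N L).filter fun y => npl1 (p.1 - y) = 0).card : ℝ) ≤ 1 := by
    exact_mod_cast (Finset.card_le_card hsub).trans (Finset.card_singleton _).le
  have hc : (0 : ℝ) ≤ Fintype.card Cp := Nat.cast_nonneg _
  nlinarith

end Faces

/-! ## §4  The consistency composition with a zero-shell COUNT (generic carrier) -/
section Card0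

/-- **The double-layer row from slices, zero shell counted** (`T4SliceTelescoping.doubleLayerRow_le` with the
hypothesis `hzero : nρ x y = 0 → y = x` replaced by a COUNT `#{y ∈ F : nρ x y = 0} ≤ A₀`): for a face set `F` whose
shells about `x` have `≤ A·r^{d−2}` sites (`r ≥ 1`) within radius `N` and whose zero shell has `≤ A₀` sites, per-slice
bounds with `p = d − 1` give `Σ_{y∈F} |Σ_i g i x y| ≤ A₀·2C + A·(C·K_δ)·(1 + log N)`. [folklore] -/
theorem doubleLayerRow_le_card0 {X : Type*} (g : ℕ → X → X → ℝ) (nρ : X → X → ℕ) {L δ C A A₀ : ℝ} {d N : ℕ}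
    (n : ℕ) (hL : 2 ≤ L) (hδ : 0 < δ) (hC : 0 ≤ C) (hA : 0 ≤ A) (hd : 2 ≤ d)
    (hg : ∀ i < n, ∀ x y,
      |g i x y| ≤ C * (Real.exp (-(δ * ((nρ x y : ℝ) / L ^ i))) / (L ^ i) ^ (d - 1)))
    (F : Finset X) (x : X) (hcard0 : ((F.filter fun y => nρ x y = 0).card : ℝ) ≤ A₀)
    (hFN : ∀ y ∈ F, nρ x y ≤ N)
    (hcard : ∀ r : ℕ, 1 ≤ r → ((F.filter fun y => nρ x y = r).card : ℝ) ≤ A * (r : ℝ) ^ (d - 2)) :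
    ∑ y ∈ F, |∑ i ∈ Finset.range n, g i x y|
      ≤ A₀ * (2 * C) + A * (C * sliceConst δ (d - 1)) * (1 + Real.log N) := by
  have hp : 1 ≤ d - 1 := by omega
  refine layer_sum_le F (fun y => nρ x y) (fun y => ∑ i ∈ Finset.range n, g i x y) hd hA
    (mul_nonneg hC (sliceConst_nonneg hδ _)) hFN hcard ?_ ?_
  · have hcore : ∀ y, |∑ i ∈ Finset.range n, g i x y| ≤ 2 * C := fun y =>
      core_of_slices g (fun u v => (nρ u v : ℝ)) n hL hδ.le hC hp (fun _ _ => Nat.cast_nonneg _) hg x y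
    calc ∑ y ∈ F.filter (fun y => nρ x y = 0), |∑ i ∈ Finset.range n, g i x y|
        ≤ ∑ _y ∈ F.filter (fun y => nρ x y = 0), 2 * C := Finset.sum_le_sum fun y _ => hcore y
      _ = ((F.filter fun y => nρ x y = 0).card : ℝ) * (2 * C) := by rw [Finset.sum_const, nsmul_eq_mul]
      _ ≤ A₀ * (2 * C) := mul_le_mul_of_nonneg_right hcard0 (by positivity)
  · intro y _ h1
    have h1' : (1 : ℝ) ≤ (nρ x y : ℝ) := by exact_mod_cast h1
    have h := profile_of_slices g (fun u v => (nρ u v : ℝ)) n hL hδ hC hp hg x y h1'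
    simpa [mul_div_assoc] using h

/-- **Clause (T2) of `ConsistencySized` from per-level slice data, zero shell counted**: `dl k V ≤ C_DL·(1 + k log L)`
with `C_DL = A₀·2C + A·C·K_δ·(1 + log ℓ)`. [folklore] -/
theorem consistencyT2_of_slices_card0 {ι : Type*} {dom : Set ι} {X : ℕ → Type*} (F : ∀ k, Finset (X k))
    (nρ : ∀ k, X k → X k → ℕ) (g : ∀ k, ι → ℕ → X k → X k → ℝ) (N : ℕ → ℕ) (dl : ℕ → ι → ℝ)
    {L δ C A A₀ ℓ : ℝ} {d : ℕ} (hL : 2 ≤ L) (hδ : 0 < δ) (hC : 0 ≤ C) (hA : 0 ≤ A) (hA₀ : 0 ≤ A₀) (hℓ : 1 ≤ ℓ)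
    (hd : 2 ≤ d)
    (hcard0 : ∀ k, ∀ x : X k, (((F k).filter fun y => nρ k x y = 0).card : ℝ) ≤ A₀)
    (hFN : ∀ k, ∀ x : X k, ∀ y ∈ F k, nρ k x y ≤ N k) (hN : ∀ k, (N k : ℝ) ≤ ℓ * L ^ k)
    (hcard : ∀ k, ∀ x : X k, ∀ r : ℕ, 1 ≤ r →
      (((F k).filter fun y => nρ k x y = r).card : ℝ) ≤ A * (r : ℝ) ^ (d - 2))
    (hg : ∀ k, ∀ V ∈ dom, ∀ i < k + 1, ∀ x y : X k,
      |g k V i x y| ≤ C * (Real.exp (-(δ * ((nρ k x y : ℝ) / L ^ i))) / (L ^ i) ^ (d - 1)))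
    (hdl : ∀ k, ∀ V ∈ dom, ∃ x : X k, dl k V ≤ ∑ y ∈ F k, |∑ i ∈ Finset.range (k + 1), g k V i x y|) :
    ∀ k : ℕ, ∀ V ∈ dom,
      dl k V ≤ (A₀ * (2 * C) + A * (C * sliceConst δ (d - 1)) * (1 + Real.log ℓ)) * (1 + k * Real.log L) := by
  intro k V hV
  obtain ⟨x, hx⟩ := hdl k V hV
  have hrow := doubleLayerRow_le_card0 (g k V) (nρ k) (k + 1) hL hδ hC hA hd (hg k V hV) (F k) x (hcard0 k x)
    (hFN k x) (hcard k x)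
  have hL1 : (1 : ℝ) ≤ L := by linarith
  have hℓL : (1 : ℝ) ≤ ℓ * L ^ k := one_le_mul_of_one_le_of_one_le hℓ (one_le_pow₀ hL1)
  have hlogN : Real.log (N k : ℝ) ≤ Real.log (ℓ * L ^ k) := by
    rcases Nat.eq_zero_or_pos (N k) with h0 | hpos
    · rw [h0, Nat.cast_zero, Real.log_zero]
      exact Real.log_nonneg hℓL
    · exact Real.log_le_log (by exact_mod_cast hpos) (hN k)
  have hAC : 0 ≤ A * (C * sliceConst δ (d - 1)) := mul_nonneg hA (mul_nonneg hC (sliceConst_nonneg hδ _))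
  calc dl k V ≤ ∑ y ∈ F k, |∑ i ∈ Finset.range (k + 1), g k V i x y| := hx
    _ ≤ A₀ * (2 * C) + A * (C * sliceConst δ (d - 1)) * (1 + Real.log (N k : ℝ)) := hrow
    _ ≤ A₀ * (2 * C) + A * (C * sliceConst δ (d - 1)) * (1 + Real.log (ℓ * L ^ k)) := by
        have hmono := mul_le_mul_of_nonneg_left
          (show 1 + Real.log (N k : ℝ) ≤ 1 + Real.log (ℓ * L ^ k) by linarith) hAC
        linarith
    _ ≤ (A₀ * (2 * C) + A * (C * sliceConst δ (d - 1)) * (1 + Real.log ℓ)) * (1 + k * Real.log L) :=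
        rowConst_le (by positivity) hA (mul_nonneg hC (sliceConst_nonneg hδ _)) hℓ hL1 k

/-- The double-layer constant with a zero-shell count is nonnegative. [folklore] -/
theorem layerConst_card0_nonneg {C A A₀ δ ℓ : ℝ} {d : ℕ} (hδ : 0 < δ) (hC : 0 ≤ C) (hA : 0 ≤ A) (hA₀ : 0 ≤ A₀)
    (hℓ : 1 ≤ ℓ) : 0 ≤ A₀ * (2 * C) + A * (C * sliceConst δ (d - 1)) * (1 + Real.log ℓ) := by
  have h1 : 0 ≤ Real.log ℓ := Real.log_nonneg hℓ
  have h2 : 0 ≤ sliceConst δ (d - 1) := sliceConst_nonneg hδ _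
  positivity

/-- **The node's shape BY NAME from slice data at any rate `L^{−a}`, zero shell counted**
(`T4TwoSpacingDefect.ne3Shape_of_consistency_rpow` ∘ `consistencyT2_of_slices_card0`; the scalar-carrier version is
`T4SliceTelescoping.ne3Shape_of_slices_rpow`). [folklore] -/
theorem ne3Shape_of_slices_rpow_card0 {ι Xr : Type*} [Fintype Xr] {R : Readings ι Xr} {X : ℕ → Type*}
    (F : ∀ k, Finset (X k)) (nρ : ∀ k, X k → X k → ℕ) (g : ∀ k, ι → ℕ → X k → X k → ℝ) (N : ℕ → ℕ)
    {z dl sig blk lam t osc nrm pair : ℕ → ι → ℝ} {L δ C A A₀ ℓ CJ CB B CP CD B0 CR Γ Λr ρ₂ a : ℝ} {d : ℕ}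
    (hL : 2 ≤ L) (ha0 : 0 < a) (ha : a < 1) (hδ : 0 < δ) (hC : 0 ≤ C) (hA : 0 ≤ A) (hA₀ : 0 ≤ A₀) (hℓ : 1 ≤ ℓ)
    (hd : 2 ≤ d)
    (hcard0 : ∀ k, ∀ x : X k, (((F k).filter fun y => nρ k x y = 0).card : ℝ) ≤ A₀)
    (hFN : ∀ k, ∀ x : X k, ∀ y ∈ F k, nρ k x y ≤ N k) (hN : ∀ k, (N k : ℝ) ≤ ℓ * L ^ k)
    (hcard : ∀ k, ∀ x : X k, ∀ r : ℕ, 1 ≤ r →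
      (((F k).filter fun y => nρ k x y = r).card : ℝ) ≤ A * (r : ℝ) ^ (d - 2))
    (hg : ∀ k, ∀ V ∈ R.dom, ∀ i < k + 1, ∀ x y : X k,
      |g k V i x y| ≤ C * (Real.exp (-(δ * ((nρ k x y : ℝ) / L ^ i))) / (L ^ i) ^ (d - 1)))
    (hdl : ∀ k, ∀ V ∈ R.dom, ∃ x : X k, dl k V ≤ ∑ y ∈ F k, |∑ i ∈ Finset.range (k + 1), g k V i x y|)
    (h1 : ∀ k : ℕ, ∀ V ∈ R.dom, z k V ≤ dl k V * sig k V + blk k V)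
    (h3 : ∀ k : ℕ, ∀ V ∈ R.dom, 0 ≤ sig k V ∧ sig k V ≤ CJ * lam k V)
    (h4 : ∀ k : ℕ, ∀ V ∈ R.dom, 0 ≤ blk k V ∧ blk k V ≤ CB * (1 + k * Real.log L) * lam k V)
    (h5 : ∀ k : ℕ, ∀ V ∈ R.dom, 0 ≤ lam k V ∧ lam k V ≤ B * (L⁻¹ ^ k) ^ 3)
    (hCJ : 0 ≤ CJ) (hCB : 0 ≤ CB) (hCP : 0 ≤ CP) (hCD : 0 ≤ CD) (hB : 0 ≤ B) (hB0 : 0 ≤ B0) (hCR : 0 ≤ CR)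
    (hΓ : 0 ≤ Γ) (hΛr : 0 ≤ Λr) (hρ₂ : 0 ≤ ρ₂)
    (ht : ∀ k : ℕ, ∀ V ∈ R.dom, t k V ≤ B0 * CR * L⁻¹ ^ k)
    (hosc : ∀ k : ℕ, ∀ V ∈ R.dom, osc k V ≤ (1 + CD) * (1 + CP) * z k V / (L⁻¹ ^ k) ^ 2 + t k V)
    (hact : ∀ k : ℕ, ∀ V ∈ R.dom, R.act k V = ∑ x, R.loc k V x) (hvol : (Fintype.card Xr : ℝ) ≤ R.vol)
    (hread : ∀ k : ℕ, ∀ V ∈ R.dom, ∀ x : Xr,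
      |R.loc (k + 1) V x - R.loc k V x| ≤ Λr * nrm k V + pair k V)
    (hresp : ∀ k : ℕ, ∀ V ∈ R.dom, nrm k V ≤ Γ * osc k V)
    (hpair : OneStepCorrectionRate R.dom pair ρ₂ (L ^ (-a))) :
    NE3Shape R (Λr * Γ * ((1 + CD) * (1 + CP) *
      ((A₀ * (2 * C) + A * (C * sliceConst δ (d - 1)) * (1 + Real.log ℓ)) * CJ + CB) * B
        * (Real.exp (-a) / (1 - a)) + B0 * CR) + ρ₂) (L ^ (-a)) := by
  have hcs : ConsistencySized R.dom z dl sig blk lam L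
      (A₀ * (2 * C) + A * (C * sliceConst δ (d - 1)) * (1 + Real.log ℓ)) CJ CB B :=
    ⟨h1, consistencyT2_of_slices_card0 F nρ g N dl hL hδ hC hA hA₀ hℓ hd hcard0 hFN hN hcard hg hdl, h3, h4, h5⟩
  exact ne3Shape_of_consistency_rpow hcs (by linarith) ha0 ha (layerConst_card0_nonneg hδ hC hA hA₀ hℓ) hCJ hCB hCP
    hCD hB hB0 hCR hΓ hΛr hρ₂ ht hosc hact hvol hread hresp hpair

end Card0

end Summit.QuantumFields.BalabanUV.T4Continuum.SliceCovariantTower
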